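import Summits.KontsevichZagierPeriods.Zeta5Search.Barrier.ConeGammaCritBox
import Summits.KontsevichZagierPeriods.Zeta5Search.Barrier.ConeGammaS7CritCoords

/-!
# ζ(5) search — BARRIER: CRITICAL VALUES ON BOXES — soundness I: the exact face polynomials are BZ's system at the
# affinely moving box point

HONEST FRAMING (cell `pub-zeta5`): systematic search; no irrationality claim unless kernel-certified. Theorems only,
about the computable checker of `ConeGammaCritBox` and BZ's §5 system (`F1R`, `F2R` of `ConeGammaRates` in the
symmetric coordinates of `ConeGammaS7CritCoords`); MODEL objects under BZ (28)+(30). Nothing about any γ of record,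
C2 (OPEN), S-E or `ζ(5)`. Theory seat cert-2 g37.

* `noise` — the noise vector of a box point `t` (`ε_i = (2D t_i − lo_i − hi_i)/(hi_i − lo_i)`, `ε₈ = η₁`,
  `ε₉ = η₂`); `abs_noise_le` (valid for `t` in the box);
* `tPoly_eval`, `linPoly_eval`, `coordPoly_eval`, `prodPoly_eval` — the integer atoms evaluate to `Q·(real atom)`;
* `f1Poly_eval`, `f2Poly_eval` (`= Q⁴·F₁`, `Q⁴·F₂` at `(X + t₆, Y + t₆)`, via `F1R_aOfS`/`F2R_aOfS`),
  `G1R`, `G2R` (the far-chart polynomials) with `g1Poly_eval`, `g2Poly_eval` and `G1R_eq`, `G2R_eq`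
  (`G₁ = Z·F₁(X, 1/Z)`, `G₂ = Z²·F₂(X, 1/Z)`);
* `sysR`, `sysPoly_eval` — the preconditioned face polynomials evaluate to `Q⁴`/`Q⁶` times the chart's system.
(The Poincaré–Miranda step is `ConeGammaCritBoxMiranda`.)
-/

noncomputable section

open Set

namespace Summit.KontsevichZagierPeriods.Zeta5Search.Barrier.ConeGamma

namespace CritBox

open Literature.Analysis.ValidatedNumerics (AForm)
open Literature.Analysis.ValidatedNumerics.AForm (Valid)

/-! ### The noise vector of a box point -/

/-- The `i`-th box noise `(2D t_i − lo_i − hi_i)/(hi_i − lo_i)`. -/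
def boxNoise (D : ℕ) (lo hi : List ℕ) (t : Fin 8 → ℝ) (i : Fin 8) : ℝ :=
  (2 * D * t i - (lo.getD i 0 : ℕ) - (hi.getD i 0 : ℕ)) / ((hi.getD i 0 : ℕ) - (lo.getD i 0 : ℕ))

/-- The noise vector of a box point: `ε_i = boxNoise i` for `i = 1..7`, `ε₈ = η₁`, `ε₉ = η₂`, else `0`. -/
def noise (D : ℕ) (lo hi : List ℕ) (t : Fin 8 → ℝ) (η₁ η₂ : ℝ) : ℕ → ℝ
  | 1 => boxNoise D lo hi t 1
  | 2 => boxNoise D lo hi t 2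
  | 3 => boxNoise D lo hi t 3
  | 4 => boxNoise D lo hi t 4
  | 5 => boxNoise D lo hi t 5
  | 6 => boxNoise D lo hi t 6
  | 7 => boxNoise D lo hi t 7
  | 8 => η₁
  | 9 => η₂
  | _ => 0

/-- On a coordinate with `lo < hi`, the box noise of a box point is in `[−1, 1]`. -/
theorem abs_boxNoise_le {D : ℕ} {lo hi : List ℕ} {t : Fin 8 → ℝ} (h : t ∈ LemmaFBox.box D lo hi) (i : Fin 8)
    (hlt : lo.getD i 0 < hi.getD i 0) : |boxNoise D lo hi t i| ≤ 1 := by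
  obtain ⟨h1, h2⟩ := h i
  have hd : (0 : ℝ) < ((hi.getD i 0 : ℕ) : ℝ) - ((lo.getD i 0 : ℕ) : ℝ) := by
    have : ((lo.getD i 0 : ℕ) : ℝ) < ((hi.getD i 0 : ℕ) : ℝ) := by exact_mod_cast hlt
    linarith
  rw [boxNoise, abs_div, abs_of_pos hd, div_le_one hd, abs_le]
  constructor <;> nlinarith

/-- The noise vector of a box point (open-box box, `|η₁|, |η₂| ≤ 1`) is valid. -/
theorem valid_noise {D : ℕ} {lo hi : List ℕ} {t : Fin 8 → ℝ} (hok : boxOKc D lo hi = true)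
    (h : t ∈ LemmaFBox.box D lo hi) {η₁ η₂ : ℝ} (h1 : |η₁| ≤ 1) (h2 : |η₂| ≤ 1) :
    Valid (noise D lo hi t η₁ η₂) := by
  simp only [boxOKc, decide_eq_true_eq] at hok
  obtain ⟨_, _, _, _, _, hall⟩ := hok
  have hlt : ∀ j : Fin 7, lo.getD (j.val + 1) 0 < hi.getD (j.val + 1) 0 := fun j => by
    have := hall j.val (List.mem_range.2 j.isLt); exact this.2.1
  intro j
  match j with
  | 0 => simp [noise]
  | 1 => exact abs_boxNoise_le h 1 (hlt 0)
  | 2 => exact abs_boxNoise_le h 2 (hlt 1)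
  | 3 => exact abs_boxNoise_le h 3 (hlt 2)
  | 4 => exact abs_boxNoise_le h 4 (hlt 3)
  | 5 => exact abs_boxNoise_le h 5 (hlt 4)
  | 6 => exact abs_boxNoise_le h 6 (hlt 5)
  | 7 => exact abs_boxNoise_le h 7 (hlt 6)
  | 8 => simpa [noise] using h1
  | 9 => simpa [noise] using h2
  | n + 10 => simp [noise]

/-! ### The atoms -/

/-- The linear part `Σ_{j<7} a_j ε_{j+1}` (coefficients listed for `j = 1..7`). -/
def linR (a : List ℤ) (ε : ℕ → ℝ) : ℝ :=
  a.getD 0 0 * ε 1 + a.getD 1 0 * ε 2 + a.getD 2 0 * ε 3 + a.getD 3 0 * ε 4 + a.getD 4 0 * ε 5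
    + a.getD 5 0 * ε 6 + a.getD 6 0 * ε 7

/-- The box coordinate `(c + Σ a_j ε_{j+1} + w·e)/Q`. -/
def coordR (c : ℤ) (a : List ℤ) (w : ℕ) (e Q : ℝ) (ε : ℕ → ℝ) : ℝ := (c + linR a ε + w * e) / Q

variable {ε : ℕ → ℝ}

/-- `prodPoly` evaluates to the product. -/
theorem prodPoly_eval (ε : ℕ → ℝ) (L : List EPoly) : EPoly.eval ε (prodPoly L) = (L.map (EPoly.eval ε)).prod := by
  induction L with
  | nil => simp [prodPoly]
  | cons p ps ih => simp [prodPoly, EPoly.eval_mul, ih]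

/-- `linPoly` evaluates to `c + Σ a_j ε_{j+1}`. -/
theorem linPoly_eval (ε : ℕ → ℝ) (c : ℤ) (a : List ℤ) : EPoly.eval ε (linPoly c a) = c + linR a ε := by
  have hr : List.range 7 = [0, 1, 2, 3, 4, 5, 6] := by rfl
  simp only [linPoly, hr, List.foldr_cons, List.foldr_nil, EPoly.eval_merge, EPoly.eval_var, EPoly.eval_const, linR]
  ring

/-- `coordPoly` evaluates to `Q·coordR` with `e = −1, 1, ε₈, ε₉` for modes `0, 1, 2, 3`. -/
theorem coordPoly_eval (ε : ℕ → ℝ) (c : ℤ) (a : List ℤ) (w : ℕ) {Q : ℝ} (hQ : Q ≠ 0) (mode : ℕ) :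
    EPoly.eval ε (coordPoly c a w mode)
      = Q * coordR c a w (if mode = 0 then -1 else if mode = 1 then 1 else if mode = 2 then ε 8 else ε 9) Q ε := by
  unfold coordPoly coordR
  split_ifs <;> simp [EPoly.eval_merge, linPoly_eval] <;> field_simp

/-- The atoms `tPoly` evaluate to `Q·t_i` at the noise of a box point (`t₀ = 1`, open-box box). -/
theorem tPoly_eval {D T : ℕ} {lo hi : List ℕ} {t : Fin 8 → ℝ} (hok : boxOKc D lo hi = true)
    (ht0 : t 0 = 1) (η₁ η₂ : ℝ) (i : Fin 8) :
    EPoly.eval (noise D lo hi t η₁ η₂) (tPoly D T lo hi i) = (2 * D * T : ℕ) * t i := by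
  simp only [boxOKc, decide_eq_true_eq] at hok
  obtain ⟨_, _, _, _, _, hall⟩ := hok
  have hlt : ∀ j : Fin 7, lo.getD (j.val + 1) 0 < hi.getD (j.val + 1) 0 := fun j => by
    have := hall j.val (List.mem_range.2 j.isLt); exact this.2.1
  have key : ∀ j : Fin 8, j ≠ 0 → noise D lo hi t η₁ η₂ j = boxNoise D lo hi t j → lo.getD j 0 < hi.getD j 0 →
      EPoly.eval (noise D lo hi t η₁ η₂) (tPoly D T lo hi j) = (2 * D * T : ℕ) * t j := by
    intro j hj hn hl
    rw [tPoly, if_neg hj, EPoly.eval_merge, EPoly.eval_const, EPoly.eval_var, hn, boxNoise]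
    have hd : (0 : ℝ) < ((hi.getD j 0 : ℕ) : ℝ) - ((lo.getD j 0 : ℕ) : ℝ) := by
      have : ((lo.getD j 0 : ℕ) : ℝ) < ((hi.getD j 0 : ℕ) : ℝ) := by exact_mod_cast hl
      linarith
    push_cast
    field_simp
    ring
  fin_cases i
  · simp [tPoly, ht0]
  · exact key 1 (by decide) rfl (hlt 0)
  · exact key 2 (by decide) rfl (hlt 1)
  · exact key 3 (by decide) rfl (hlt 2)
  · exact key 4 (by decide) rfl (hlt 3)
  · exact key 5 (by decide) rfl (hlt 4)
  · exact key 6 (by decide) rfl (hlt 5)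
  · exact key 7 (by decide) rfl (hlt 6)

/-! ### The systems -/

section Sys
variable {tP : Fin 8 → EPoly} {t : Fin 8 → ℝ} {Q X V : ℝ} {XP VP : EPoly}

/-- `f1Poly` is `Q⁴·F₁(X + t₆, Y + t₆)`. -/
theorem f1Poly_eval (ht : ∀ i, EPoly.eval ε (tP i) = Q * t i) (hX : EPoly.eval ε XP = Q * X)
    (hV : EPoly.eval ε VP = Q * V) :
    EPoly.eval ε (f1Poly tP XP VP) = Q ^ 4 * F1R (pR (aOfS t)) (qR (aOfS t)) (X + t 6) (V + t 6) := by
  simp only [f1Poly, prodPoly_eval, List.map, List.prod_cons, List.prod_nil, EPoly.eval_merge, EPoly.eval_smul,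
    ht, hX, hV, F1R_aOfS]
  push_cast; ring

/-- `f2Poly` is `Q⁴·F₂(X + t₆, Y + t₆)`. -/
theorem f2Poly_eval (ht : ∀ i, EPoly.eval ε (tP i) = Q * t i) (hX : EPoly.eval ε XP = Q * X)
    (hV : EPoly.eval ε VP = Q * V) :
    EPoly.eval ε (f2Poly tP XP VP) = Q ^ 4 * F2R (pR (aOfS t)) (qR (aOfS t)) (X + t 6) (V + t 6) := by
  simp only [f2Poly, prodPoly_eval, List.map, List.prod_cons, List.prod_nil, EPoly.eval_merge, EPoly.eval_smul,
    ht, hX, hV, F2R_aOfS]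
  push_cast; ring

/-- The far-chart polynomial `G₁(X,Z) = A₁(X) + B₁(X)·Z` (`F₁ = A₁Y + B₁`). -/
def G1R (t : Fin 8 → ℝ) (X Z : ℝ) : ℝ :=
  let L := (X + t 6) * (t 0 - X) * (t 3 + t 4 + t 5 - X)
  let R := (X - t 4) * (X - t 3) * (X - t 5)
  (L - R) + (L * X - R * (X + t 6 - t 0)) * Z

/-- The far-chart polynomial `G₂(X,Z) = c₂ + c₁Z + c₀Z²` (`F₂ = c₂Y² + c₁Y + c₀`). -/
def G2R (t : Fin 8 → ℝ) (X Z : ℝ) : ℝ :=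
  let sp := t 1 + t 2 + t 7
  let e2 := t 1 * t 2 + t 1 * t 7 + t 2 * t 7
  let e3 := t 1 * t 2 * t 7
  let d := t 6 - t 0
  ((d * X) - (t 0 * t 6 + e2)) + (((X + t 6) * sp * t 0 - X * t 6 * (sp + t 0)) + (-((X + d) * e2) + e3)) * Z
    + ((X * t 6 * sp * t 0) + (X + d) * e3) * Z ^ 2

/-- `g1Poly` is `Q⁵·G₁`. -/
theorem g1Poly_eval {Qn : ℕ} (hQ : (Qn : ℝ) = Q) (ht : ∀ i, EPoly.eval ε (tP i) = Q * t i)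
    (hX : EPoly.eval ε XP = Q * X) (hV : EPoly.eval ε VP = Q * V) :
    EPoly.eval ε (g1Poly tP Qn XP VP) = Q ^ 5 * G1R t X V := by
  simp only [g1Poly, a1b1Poly, prodPoly_eval, List.map, List.prod_cons, List.prod_nil, EPoly.eval_merge,
    EPoly.eval_smul, EPoly.eval_mul, ht, hX, hV, G1R]
  push_cast; rw [hQ]; ring

/-- `g2Poly` is `Q⁶·G₂`. -/
theorem g2Poly_eval {Qn : ℕ} (hQ : (Qn : ℝ) = Q) (ht : ∀ i, EPoly.eval ε (tP i) = Q * t i)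
    (hX : EPoly.eval ε XP = Q * X) (hV : EPoly.eval ε VP = Q * V) :
    EPoly.eval ε (g2Poly tP Qn XP VP) = Q ^ 6 * G2R t X V := by
  simp only [g2Poly, cPoly, EPoly.eval_merge, EPoly.eval_smul, EPoly.eval_mul, ht, hX, hV, G2R]
  push_cast; rw [hQ]; ring

/-- `G₁ = Z·F₁(X + t₆, 1/Z + t₆)`. -/
theorem G1R_eq (t : Fin 8 → ℝ) (X : ℝ) {Z : ℝ} (hZ : Z ≠ 0) :
    G1R t X Z = Z * F1R (pR (aOfS t)) (qR (aOfS t)) (X + t 6) (Z⁻¹ + t 6) := by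
  rw [F1R_aOfS, G1R]; field_simp; ring

/-- `G₂ = Z²·F₂(X + t₆, 1/Z + t₆)`. -/
theorem G2R_eq (t : Fin 8 → ℝ) (X : ℝ) {Z : ℝ} (hZ : Z ≠ 0) :
    G2R t X Z = Z ^ 2 * F2R (pR (aOfS t)) (qR (aOfS t)) (X + t 6) (Z⁻¹ + t 6) := by
  rw [F2R_aOfS, G2R]; field_simp; ring

end Sys

/-- The chart's two polynomials at the point `(X, V)`: near `(F₁, F₂)(X + t₆, V + t₆)`, far `(G₁, G₂)(X, V)`. -/
def sysR (far : Bool) (t : Fin 8 → ℝ) (X V : ℝ) : ℝ × ℝ :=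
  if far then (G1R t X V, G2R t X V)
  else (F1R (pR (aOfS t)) (qR (aOfS t)) (X + t 6) (V + t 6), F2R (pR (aOfS t)) (qR (aOfS t)) (X + t 6) (V + t 6))

/-- `sysPoly` evaluates to `Q⁴` resp. `Q⁶` times a preconditioned component of `sysR`. -/
theorem sysPoly_eval {D T : ℕ} {lo hi : List ℕ} {t : Fin 8 → ℝ} (hok : boxOKc D lo hi = true)
    (ht0 : t 0 = 1) (η₁ η₂ : ℝ) (rd : RootData) {XP VP : EPoly} {X V : ℝ}
    (hX : EPoly.eval (noise D lo hi t η₁ η₂) XP = (2 * D * T : ℕ) * X)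
    (hV : EPoly.eval (noise D lo hi t η₁ η₂) VP = (2 * D * T : ℕ) * V) (second : Bool) :
    EPoly.eval (noise D lo hi t η₁ η₂) (sysPoly D T lo hi rd XP VP second)
      = ((2 * D * T : ℕ) : ℝ) ^ (if rd.far then 6 else 4) *
        (if second then rd.m21 * (sysR rd.far t X V).1 + rd.m22 * (sysR rd.far t X V).2
         else rd.m11 * (sysR rd.far t X V).1 + rd.m12 * (sysR rd.far t X V).2) := by
  have ht := tPoly_eval (T := T) hok ht0 η₁ η₂
  unfold sysPoly sysR
  cases hf : rd.far <;> cases second <;>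
    simp only [if_true, if_false, Bool.false_eq_true, EPoly.eval_merge, EPoly.eval_smul,
      f1Poly_eval ht hX hV, f2Poly_eval ht hX hV, g1Poly_eval rfl ht hX hV, g2Poly_eval rfl ht hX hV] <;>
    push_cast <;> ring

end CritBox

end Summit.KontsevichZagierPeriods.Zeta5Search.Barrier.ConeGamma

end
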